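import Summits.QuantumFields.BalabanUV.Beta.GAN24.MonotoneTorusRate
import Literature.MathematicalPhysics.QuantumFieldTheory.Balaban1983to89.Beta.MonotoneScales

/-!
# Beta / GAN24 / MonotoneTorusCovRate — ROAD P4's «ONE DATUM» MADE EXPLICIT: the plaquette covariances of the block-constrained `U = 1` field
# converge at the geometric rate `θ = Lc⁻²`, `0 ≤ plaqCov R k − plaqCov R ∞ ≤ Crate·Lc^{−2k}·plaqCov R k ≤ Crate·Lc^{−2k}·1` (Loewner), hence
# `‖(plaqCov R k − plaqCov R ∞) a b‖ ≤ Crate d·Lc^{−2k}` for EVERY constraint `R`, torus, `d`, `Lc ≥ 2`, entry — by the Gaussian variational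
# principle applied to the two forms `effAction k ≤ effInf ≤ effAction k + Crate·Lc^{−2k}·curlᴴcurl` of `GAN24/MonotoneTorusRate`
# (binder row G-an2-4 ∕ (CONV-C); road P2 seat gan24-p2 gen 28, auditing candidate route R1 of `HOME/beta/ROUTES-GAN24.md` v1; NOT IN PRINT — our proof attempt)

HONEST FRAMING (page 1 of everything the β sub-cell writes): discharging `BetaPertH` makes Bałaban's UV stability UNCONDITIONAL — a
real constructive-QFT result; it is NOT the continuum limit and NOT the Clay problem.  HONEST DEPENDENCY (cell reorg 2026-08-19, verbatim):
«continuum YM on T⁴ ⇐ BetaPertH ∧ nine spine estimates (0/9 proved); BetaPertH ⇐ (D1) ∧ (D4) ∧ CAP+tail; G-an2-4 gates asym, D1 and NE2/3/4.»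
HONEST LABEL: «not in print; our proof attempt»; 0 wall binders instantiated; NEVER «G-an2-4 closed».

ABSOLUTE RULE (cell charter, verbatim): "No internally-minted statement may enter as a cited fact. Every hypothesis is either
kernel-proved in this package or a verbatim quotation of a PUBLISHED theorem with page reference. The manuscript(s) under audit are
NOT citable for their own disputed steps — they are the thing under adjudication; programme-internal (2001/route/tribunal) claims
are never citable."  Nothing is cited; [folklore] finite-dimensional linear algebra over tree theorems used BY NAME; no `def … : Prop`.

## WHY
Road P4's torus avatar (`MonotoneTorusPlaquette`, `MonotoneTorusEffective(Limit)`) proves that the plaquette covariances `plaqCov R k` of the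
block-constrained `U = 1` field DECREASE in `k` to the identified limit `curlMat·critCov effInf R·curlMatᴴ` and turns ONE trace datum
`re tr(plaqCov R k₀ − plaqCov R j) ≤ η₀` into an entrywise band (`plaqCov_entry_dev_le`, `plaqCov_sub_effInf_le`) — but supplies no `η₀`.
`GAN24/MonotoneTorusRate` (this seat) gave the ACTION side a rate.  THIS FILE transports it to the COVARIANCE side by the variational principle
(`MonotoneCoarsen.qfun_le_of_isCrit`): for two PSD forms `H ≤ H′` with critical columns `v, v′` at the same source on the same constraint space,
`0 ≤ ⟨r,v⟩ − ⟨r,v′⟩ ≤ ⟨v,(H′ − H)v⟩` (the `H`-column is a competitor in the `H′`-problem); with `H = effAction k`, `H′ = effInf`,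
`H′ − H ≤ eps_k·curlᴴcurl`, `curlᴴcurl ≤ effAction k` (the lower (1.67) with constant 1, asym1's `MonotoneScales.d1Sq_le_formDk`) and
`⟨v, effAction k v⟩ = ⟨r, v⟩` at a critical point, the datum is `η₀(k₀) = Crate d·Lc^{−2k₀}` per entry.

## WHAT IS PROVED (0 sorry; every `d`, read-out torus `Tor M`, `Lc ≥ 2`, every constraint matrix `R`)
* §1 (abstract, `ℂ`): `crit_energy_eq_pairing`, **`pairing_antitone_re`** (`H ≤ H′` ⟹ `re⟨r,v′⟩ ≤ re⟨r,v⟩`), **`pairing_sub_le_re`**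
  (`re⟨r,v⟩ − re⟨r,v′⟩ ≤ re⟨v,(H′−H)v⟩`).
* §2 `plaqCovInf R := curlMat·critCov effInf R·curlMatᴴ` (P4's limit object, named); quadratic-form dictionaries; `curlEnergy_col_le_quad`
  (`‖curl v_k‖² ≤ re⟨F, plaqCov R k F⟩`), **`plaqCov_quad_le_nsq`** (`re⟨F, plaqCov R k F⟩ ≤ Σ|F|²`: the covariance is a contraction).
* §3 **`plaqCov_quad_rate`**: `0 ≤ re⟨F,(plaqCov R k − plaqCovInf R)F⟩ ≤ eps_k·re⟨F, plaqCov R k F⟩ ≤ eps_k·Σ|F|²`, `eps_k = Crate d·(Lc^k)⁻²`;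
  Loewner forms **`plaqCov_sub_inf_le_smul`**, **`plaqCov_sub_inf_le_one`**; one-step∕tail `plaqCov_sub_le_one` (`k ≤ k′`).
* §4 entrywise: **`norm_plaqCov_sub_inf_apply_le`** `‖(plaqCov R k − plaqCovInf R) a b‖ ≤ eps_k`, **`norm_plaqCov_sub_apply_le`**
  (`k ≤ k′`: `≤ eps_k`), and road P4's datum in its own shape **`plaqCov_datum`**: `∀ j ≥ k₀, ∀ a b, ‖(plaqCov R j − plaqCovInf R) a b‖ ≤ Crate d·(Lc^{k₀})⁻²`.
WHAT THIS IS NOT: the plaquette covariance of the torus MODEL of the constituents (U = 1, hard constraint, no gauge fixing needed), not an2's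
literal tables nor the CAP rows' certified numbers; no position-space decay; constants the tree's (`Crate`), not optimised; NOT (CONV-C) as typed,
NOT D1, NOT BetaPertH, NOT continuum, NOT Clay.
-/

noncomputable section

namespace Summit.QuantumFields.BalabanUV.Beta.GAN24.MonotoneTorusCovRate

open Matrix
open scoped BigOperators ComplexOrder
open Literature.MathematicalPhysics.QuantumFieldTheory.Balaban1983to89
open Literature.MathematicalPhysics.QuantumFieldTheory.Balaban1983to89.B5Prop11Plancherel (Tor)
open Literature.MathematicalPhysics.QuantumFieldTheory.Balaban1983to89.B5Prop11Lower (nsq nsq_nonneg star_dotProduct_self norm_star_dotProduct_le)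
open Literature.MathematicalPhysics.QuantumFieldTheory.Balaban1983to89.B5Bounds167Lattice (d1Sq formDk)
open Literature.MathematicalPhysics.QuantumFieldTheory.Balaban1983to89.B5ActionRate166 (Crate Crate_nonneg)
open Literature.MathematicalPhysics.QuantumFieldTheory.Balaban1983to89.Beta.MonotoneScales (d1Sq_le_formDk)
open Summit.QuantumFields.BalabanUV.Beta.GAN24.MonotoneCoarsen (qfun IsCrit qfun_le_of_isCrit qfun_crit_eq_pairing conj_pairing)
open Summit.QuantumFields.BalabanUV.Beta.GAN24.MonotoneCritical (critCov critCov_isHermitian isCrit_critCov)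
open Summit.QuantumFields.BalabanUV.Beta.GAN24.MonotoneLoewner (posSemidef_of_isHermitian_re_nonneg norm_apply_sq_le re_diag_nonneg)
open Summit.QuantumFields.BalabanUV.Beta.GAN24.MonotoneTorusTower (curlMat curlEnergy curlEnergy_nonneg quad_curlMat quad_conjTranspose_mul_self)
open Summit.QuantumFields.BalabanUV.Beta.GAN24.MonotoneTorusEffective (effAction effAction_isHermitian effAction_posSemidef effAction_step_mono
  curlMat_of_effAction_ker plaqCov_eq_critCov_effAction one_le_pow_Lc)
open Summit.QuantumFields.BalabanUV.Beta.GAN24.MonotoneTorusEffectiveLimit (effInf effInf_posSemidef effAction_le_effInf effInf_ker_iff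
  d1Sq_eq_half_curlEnergy)
open Summit.QuantumFields.BalabanUV.Beta.GAN24.MonotoneTorusPlaquette (plaqCov plaqCov_posSemidef plaqCov_antitone)
open Summit.QuantumFields.BalabanUV.Beta.GAN24.MonotoneTorusRate (eps eps_nonneg eps_succ_le rateBound rateBound_quad_re effInf_sub_effAction_le
  effAction_quad_re)

/-! ## §1 Abstract: two PSD forms on the same constraint space — the competitor bound for critical columns -/

section Abstract

variable {n : Type*} [Fintype n]

/-- At a critical point the energy equals the pairing: `⟨v, Hv⟩ = ⟨v, r⟩`. [folklore] -/
theorem crit_energy_eq_pairing {H : Matrix n n ℂ} {r v : n → ℂ} {K : Submodule ℂ (n → ℂ)} (h : IsCrit H r K v) :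
    star v ⬝ᵥ (H *ᵥ v) = star v ⬝ᵥ r := by
  have h0 := h.2 v h.1
  rw [dotProduct_sub, sub_eq_zero] at h0
  exact h0.symm

/-- The real part of the pairing at a critical point is the energy: `re⟨r,v⟩ = re⟨v,Hv⟩` (`⟨r,v⟩ = conj⟨v,r⟩ = conj⟨v,Hv⟩`). [folklore] -/
theorem re_pairing_eq_re_energy {H : Matrix n n ℂ} {r v : n → ℂ} {K : Submodule ℂ (n → ℂ)} (h : IsCrit H r K v) :
    (star r ⬝ᵥ v).re = (star v ⬝ᵥ (H *ᵥ v)).re := by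
  rw [crit_energy_eq_pairing h]
  rw [star_dotProduct r v, Complex.star_def, Complex.conj_re]

/-- **ANTITONE**: `H ≤ H′` (PSD difference), `H` PSD, `v` critical for `(H,r)` and `v′` for `(H′,r)` on the same `K` ⟹ `re⟨r,v′⟩ ≤ re⟨r,v⟩`. [folklore] -/
theorem pairing_antitone_re {H H' : Matrix n n ℂ} (hH : H.PosSemidef) (hle : (H' - H).PosSemidef) {r v v' : n → ℂ}
    {K : Submodule ℂ (n → ℂ)} (hv : IsCrit H r K v) (hv' : IsCrit H' r K v') : (star r ⬝ᵥ v').re ≤ (star r ⬝ᵥ v).re := by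
  have h1 := qfun_le_of_isCrit hH hv hv'.1
  rw [qfun_crit_eq_pairing hv] at h1
  have h1re := (Complex.le_def.mp h1).1
  -- `qfun H r v' = ⟨r,v'⟩ + ⟨v',(H'−H)v'⟩` (using `⟨v',r⟩ = ⟨v',H'v'⟩`)
  have e : qfun H r v' = star r ⬝ᵥ v' + star v' ⬝ᵥ ((H' - H) *ᵥ v') := by
    rw [qfun, crit_energy_eq_pairing hv' |>.symm, sub_mulVec, dotProduct_sub]; ring
  rw [e, Complex.add_re] at h1re
  have h2 := (Complex.nonneg_iff.mp (hle.dotProduct_mulVec_nonneg v')).1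
  linarith

/-- **COMPETITOR BOUND**: `H′` PSD, `v` critical for `(H,r)` and `v′` for `(H′,r)` on the same `K` ⟹ `re⟨r,v⟩ − re⟨r,v′⟩ ≤ re⟨v,(H′−H)v⟩`
(insert the `H`-column into the `H′`-problem). [folklore] -/
theorem pairing_sub_le_re {H H' : Matrix n n ℂ} (hH' : H'.PosSemidef) {r v v' : n → ℂ} {K : Submodule ℂ (n → ℂ)}
    (hv : IsCrit H r K v) (hv' : IsCrit H' r K v') :
    (star r ⬝ᵥ v).re - (star r ⬝ᵥ v').re ≤ (star v ⬝ᵥ ((H' - H) *ᵥ v)).re := by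
  have h1 := qfun_le_of_isCrit hH' hv' hv.1
  rw [qfun_crit_eq_pairing hv'] at h1
  have h1re := (Complex.le_def.mp h1).1
  have e : qfun H' r v = star r ⬝ᵥ v - star v ⬝ᵥ ((H' - H) *ᵥ v) := by
    rw [qfun, crit_energy_eq_pairing hv |>.symm, sub_mulVec, dotProduct_sub]; ring
  rw [e, Complex.sub_re] at h1re
  linarith

end Abstract

/-! ## §2 The torus objects: the limit plaquette covariance, the critical columns, contraction -/

variable {d : ℕ} (Lc : ℕ) [NeZero Lc] (M : Fin d → ℕ) [hM : ∀ μ, NeZero (M μ)]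
variable {c : Type*} [Fintype c] [DecidableEq c]

/-- **road P4's limit plaquette covariance, named**: `plaqCovInf R := curlMat·critCov effInf R·curlMatᴴ` (`MonotoneTorusEffectiveLimit.plaqCov_tendsto_effInf`). [folklore] -/
def plaqCovInf (R : Matrix c (Tor M × Fin d) ℂ) : Matrix (Fin d × Fin d × Tor M) (Fin d × Fin d × Tor M) ℂ :=
  curlMat M * critCov (effInf_posSemidef Lc M).isHermitian R * (curlMat M)ᴴ

/-- `plaqCovInf R` is Hermitian. [folklore] -/
theorem plaqCovInf_isHermitian (R : Matrix c (Tor M × Fin d) ℂ) : (plaqCovInf Lc M R).IsHermitian := by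
  unfold plaqCovInf
  exact Matrix.isHermitian_mul_mul_conjTranspose _ (critCov_isHermitian _ _)

/-- the critical column of level `k` at the plaquette source `curlᴴF`. [folklore] -/
def col (R : Matrix c (Tor M × Fin d) ℂ) (k : ℕ) (F : Fin d × Fin d × Tor M → ℂ) : Tor M × Fin d → ℂ :=
  critCov (effAction_isHermitian Lc M k) R *ᵥ ((curlMat M)ᴴ *ᵥ F)

/-- the critical column of the limit form at the plaquette source `curlᴴF`. [folklore] -/
def colInf (R : Matrix c (Tor M × Fin d) ℂ) (F : Fin d × Fin d × Tor M → ℂ) : Tor M × Fin d → ℂ :=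
  critCov (effInf_posSemidef Lc M).isHermitian R *ᵥ ((curlMat M)ᴴ *ᵥ F)

omit [NeZero Lc] in
/-- plaquette sources see no curl-free vector: `curl z = 0 ⟹ ⟨z, curlᴴF⟩ = 0`. [folklore] -/
theorem source_orth_of_curl_zero {z : Tor M × Fin d → ℂ} (hz : curlMat M *ᵥ z = 0) (F : Fin d × Fin d × Tor M → ℂ) :
    star z ⬝ᵥ ((curlMat M)ᴴ *ᵥ F) = 0 := by
  rw [← conj_pairing, hz, star_zero, zero_dotProduct]

/-- the level-`k` column is critical for `effAction k` on `ker R`. [folklore] -/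
theorem isCrit_col (R : Matrix c (Tor M × Fin d) ℂ) (k : ℕ) (F : Fin d × Fin d × Tor M → ℂ) :
    IsCrit (effAction Lc M k) ((curlMat M)ᴴ *ᵥ F) (LinearMap.ker R.mulVecLin) (col Lc M R k F) :=
  isCrit_critCov (effAction_posSemidef Lc M k) R fun _ _ hz => source_orth_of_curl_zero M (curlMat_of_effAction_ker Lc M k hz) F

/-- the limit column is critical for `effInf` on `ker R` (zero modes of `effInf` are those of `effAction 0`, hence curl-free). [folklore] -/
theorem isCrit_colInf (R : Matrix c (Tor M × Fin d) ℂ) (F : Fin d × Fin d × Tor M → ℂ) :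
    IsCrit (effInf Lc M) ((curlMat M)ᴴ *ᵥ F) (LinearMap.ker R.mulVecLin) (colInf Lc M R F) :=
  isCrit_critCov (effInf_posSemidef Lc M) R fun z _ hz =>
    source_orth_of_curl_zero M (curlMat_of_effAction_ker Lc M 0 ((effInf_ker_iff Lc M z).mp hz)) F

/-- `⟨F, plaqCov R k F⟩ = ⟨curlᴴF, col k F⟩`. [folklore] -/
theorem plaqCov_quad_eq (R : Matrix c (Tor M × Fin d) ℂ) (k : ℕ) (F : Fin d × Fin d × Tor M → ℂ) :
    star F ⬝ᵥ (plaqCov Lc M R k *ᵥ F) = star ((curlMat M)ᴴ *ᵥ F) ⬝ᵥ col Lc M R k F := by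
  rw [plaqCov_eq_critCov_effAction, col, ← mulVec_mulVec, ← mulVec_mulVec, conj_pairing, conjTranspose_conjTranspose]

/-- `⟨F, plaqCovInf R F⟩ = ⟨curlᴴF, colInf F⟩`. [folklore] -/
theorem plaqCovInf_quad_eq (R : Matrix c (Tor M × Fin d) ℂ) (F : Fin d × Fin d × Tor M → ℂ) :
    star F ⬝ᵥ (plaqCovInf Lc M R *ᵥ F) = star ((curlMat M)ᴴ *ᵥ F) ⬝ᵥ colInf Lc M R F := by
  rw [plaqCovInf, colInf, ← mulVec_mulVec, ← mulVec_mulVec, conj_pairing, conjTranspose_conjTranspose]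

omit [NeZero Lc] in
/-- the lower (1.67) with constant `1` in `curlEnergy` currency: `curlEnergy B ≤ re⟨B, effAction k B⟩` (asym1's `d1Sq_le_formDk`). [folklore] -/
theorem curlEnergy_le_effAction_quad [NeZero Lc] (k : ℕ) (B : Tor M × Fin d → ℂ) :
    curlEnergy M B ≤ (star B ⬝ᵥ (effAction Lc M k *ᵥ B)).re := by
  rw [effAction_quad_re]
  have h := d1Sq_le_formDk M (Lc ^ k) (one_le_pow_Lc Lc k) B
  rw [d1Sq_eq_half_curlEnergy] at h
  linarith

omit [NeZero Lc] in
/-- `curlEnergy v = Σ |(curl v)_i|² = nsq (curl v)`. [folklore] -/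
theorem curlEnergy_eq_nsq (v : Tor M × Fin d → ℂ) : curlEnergy M v = nsq (curlMat M *ᵥ v) := by
  have h1 := quad_curlMat M v
  rw [quad_conjTranspose_mul_self] at h1
  have h2 := congrArg Complex.re h1
  simp only [Complex.ofReal_re] at h2
  rw [← h2]; rfl

/-- **the column's curl energy is below the covariance form**: `curlEnergy (col k F) ≤ re⟨F, plaqCov R k F⟩`. [folklore] -/
theorem curlEnergy_col_le_quad (R : Matrix c (Tor M × Fin d) ℂ) (k : ℕ) (F : Fin d × Fin d × Tor M → ℂ) :
    curlEnergy M (col Lc M R k F) ≤ (star F ⬝ᵥ (plaqCov Lc M R k *ᵥ F)).re := by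
  rw [plaqCov_quad_eq, re_pairing_eq_re_energy (isCrit_col Lc M R k F)]
  exact curlEnergy_le_effAction_quad Lc M k _

/-- **THE PLAQUETTE COVARIANCE IS A CONTRACTION**: `re⟨F, plaqCov R k F⟩ ≤ Σ_i |F_i|²` (every `R`, `k`, torus). [folklore] -/
theorem plaqCov_quad_le_nsq (R : Matrix c (Tor M × Fin d) ℂ) (k : ℕ) (F : Fin d × Fin d × Tor M → ℂ) :
    (star F ⬝ᵥ (plaqCov Lc M R k *ᵥ F)).re ≤ nsq F := by
  set P : ℝ := (star F ⬝ᵥ (plaqCov Lc M R k *ᵥ F)).re with hP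
  have hP0 : 0 ≤ P := (Complex.nonneg_iff.mp ((plaqCov_posSemidef Lc M R k).dotProduct_mulVec_nonneg F)).1
  have hw : nsq (curlMat M *ᵥ col Lc M R k F) ≤ P := by rw [← curlEnergy_eq_nsq]; exact curlEnergy_col_le_quad Lc M R k F
  -- `P = re⟨F, curl·col⟩ ≤ ‖F‖·‖curl·col‖`
  have hPe : P = (star F ⬝ᵥ (curlMat M *ᵥ col Lc M R k F)).re := by
    rw [hP, plaqCov_quad_eq, conj_pairing, conjTranspose_conjTranspose]
  have hcs : P ≤ Real.sqrt (nsq F) * Real.sqrt (nsq (curlMat M *ᵥ col Lc M R k F)) := by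
    rw [hPe]; exact (Complex.re_le_norm _).trans (norm_star_dotProduct_le _ _)
  have hs : Real.sqrt (nsq (curlMat M *ᵥ col Lc M R k F)) ≤ Real.sqrt P := Real.sqrt_le_sqrt hw
  have hF0 : 0 ≤ Real.sqrt (nsq F) := Real.sqrt_nonneg _
  have h3 : P ≤ Real.sqrt (nsq F) * Real.sqrt P := hcs.trans (mul_le_mul_of_nonneg_left hs hF0)
  -- `P ≤ √(nsq F)·√P` ⟹ `P ≤ nsq F`
  by_cases hP1 : P = 0
  · rw [hP1]; exact nsq_nonneg F
  · have hPpos : 0 < P := lt_of_le_of_ne hP0 (Ne.symm hP1)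
    have hsP : 0 < Real.sqrt P := Real.sqrt_pos.mpr hPpos
    have h4 : Real.sqrt P ≤ Real.sqrt (nsq F) := by
      have : Real.sqrt P * Real.sqrt P ≤ Real.sqrt (nsq F) * Real.sqrt P := by rw [Real.mul_self_sqrt hP0]; exact h3
      exact le_of_mul_le_mul_right this hsP
    calc P = Real.sqrt P ^ 2 := (Real.sq_sqrt hP0).symm
      _ ≤ Real.sqrt (nsq F) ^ 2 := by gcongr
      _ = nsq F := Real.sq_sqrt (nsq_nonneg F)

/-! ## §3 The rate: `0 ≤ plaqCov R k − plaqCovInf R ≤ eps_k • plaqCov R k ≤ eps_k • 1` -/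

/-- **THE COVARIANCE RATE, form level**: for `Lc ≥ 2`, every `R`, `k`, `F`:
`0 ≤ re⟨F,(plaqCov R k − plaqCovInf R)F⟩ ≤ eps_k·re⟨F, plaqCov R k F⟩ ≤ eps_k·Σ|F|²`, `eps_k = Crate d·(Lc^k)⁻²`. [folklore] -/
theorem plaqCov_quad_rate (hL : 2 ≤ Lc) (R : Matrix c (Tor M × Fin d) ℂ) (k : ℕ) (F : Fin d × Fin d × Tor M → ℂ) :
    0 ≤ (star F ⬝ᵥ ((plaqCov Lc M R k - plaqCovInf Lc M R) *ᵥ F)).re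
      ∧ (star F ⬝ᵥ ((plaqCov Lc M R k - plaqCovInf Lc M R) *ᵥ F)).re ≤ eps d Lc k * (star F ⬝ᵥ (plaqCov Lc M R k *ᵥ F)).re
      ∧ eps d Lc k * (star F ⬝ᵥ (plaqCov Lc M R k *ᵥ F)).re ≤ eps d Lc k * nsq F := by
  have hsub : (star F ⬝ᵥ ((plaqCov Lc M R k - plaqCovInf Lc M R) *ᵥ F)).re
      = (star ((curlMat M)ᴴ *ᵥ F) ⬝ᵥ col Lc M R k F).re - (star ((curlMat M)ᴴ *ᵥ F) ⬝ᵥ colInf Lc M R F).re := by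
    rw [sub_mulVec, dotProduct_sub, Complex.sub_re, plaqCov_quad_eq, plaqCovInf_quad_eq]
  refine ⟨?_, ?_, mul_le_mul_of_nonneg_left (plaqCov_quad_le_nsq Lc M R k F) (eps_nonneg Lc k)⟩
  · rw [hsub, sub_nonneg]
    exact pairing_antitone_re (effAction_posSemidef Lc M k) (effAction_le_effInf Lc M k) (isCrit_col Lc M R k F) (isCrit_colInf Lc M R F)
  · rw [hsub]
    have h1 := pairing_sub_le_re (effInf_posSemidef Lc M) (isCrit_col Lc M R k F) (isCrit_colInf Lc M R F)
    -- `re⟨v,(effInf − effAction k)v⟩ ≤ re⟨v, rateBound k v⟩ = eps_k·curlEnergy v ≤ eps_k·re⟨F, plaqCov k F⟩`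
    have h2 := (Complex.nonneg_iff.mp ((effInf_sub_effAction_le Lc M hL k).dotProduct_mulVec_nonneg (col Lc M R k F))).1
    rw [sub_mulVec, dotProduct_sub, Complex.sub_re, rateBound_quad_re] at h2
    have h3 := curlEnergy_col_le_quad Lc M R k F
    have h4 := eps_nonneg (d := d) Lc k
    nlinarith

/-- `plaqCov R k − plaqCovInf R` is PSD (road P4's antitone chain at the limit). [folklore] -/
theorem plaqCov_sub_inf_posSemidef (hL : 2 ≤ Lc) (R : Matrix c (Tor M × Fin d) ℂ) (k : ℕ) :
    (plaqCov Lc M R k - plaqCovInf Lc M R).PosSemidef :=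
  posSemidef_of_isHermitian_re_nonneg ((plaqCov_posSemidef Lc M R k).isHermitian.sub (plaqCovInf_isHermitian Lc M R))
    fun F => (plaqCov_quad_rate Lc M hL R k F).1

/-- **Loewner: `plaqCov R k − plaqCovInf R ≤ eps_k • plaqCov R k`**. [folklore] -/
theorem plaqCov_sub_inf_le_smul (hL : 2 ≤ Lc) (R : Matrix c (Tor M × Fin d) ℂ) (k : ℕ) :
    (((eps d Lc k : ℝ) : ℂ) • plaqCov Lc M R k - (plaqCov Lc M R k - plaqCovInf Lc M R)).PosSemidef := by
  refine posSemidef_of_isHermitian_re_nonneg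
    (((plaqCov_posSemidef Lc M R k).isHermitian.smul (by rw [IsSelfAdjoint, Complex.star_def, Complex.conj_ofReal])).sub
      ((plaqCov_posSemidef Lc M R k).isHermitian.sub (plaqCovInf_isHermitian Lc M R))) fun F => ?_
  have h := (plaqCov_quad_rate Lc M hL R k F).2.1
  rw [sub_mulVec, dotProduct_sub, Complex.sub_re, smul_mulVec, dotProduct_smul, smul_eq_mul, Complex.re_ofReal_mul]
  linarith

/-- **Loewner: `plaqCov R k − plaqCovInf R ≤ eps_k • 1`** (the covariance is a contraction). [folklore] -/
theorem plaqCov_sub_inf_le_one (hL : 2 ≤ Lc) (R : Matrix c (Tor M × Fin d) ℂ) (k : ℕ) :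
    (((eps d Lc k : ℝ) : ℂ) • (1 : Matrix _ _ ℂ) - (plaqCov Lc M R k - plaqCovInf Lc M R)).PosSemidef := by
  refine posSemidef_of_isHermitian_re_nonneg
    ((Matrix.isHermitian_one.smul (by rw [IsSelfAdjoint, Complex.star_def, Complex.conj_ofReal])).sub
      ((plaqCov_posSemidef Lc M R k).isHermitian.sub (plaqCovInf_isHermitian Lc M R))) fun F => ?_
  have h := plaqCov_quad_rate Lc M hL R k F
  rw [sub_mulVec, dotProduct_sub, Complex.sub_re, smul_mulVec, dotProduct_smul, smul_eq_mul, Complex.re_ofReal_mul, one_mulVec,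
    star_dotProduct_self, Complex.ofReal_re]
  linarith [h.2.1, h.2.2]

/-- **ONE-STEP ∕ TAIL in Loewner order**: for `k ≤ k′`, `0 ≤ plaqCov R k − plaqCov R k′ ≤ eps_k • 1`. [folklore] -/
theorem plaqCov_sub_le_one (hL : 2 ≤ Lc) (R : Matrix c (Tor M × Fin d) ℂ) {k k' : ℕ} (hkk' : k ≤ k') :
    (plaqCov Lc M R k - plaqCov Lc M R k').PosSemidef
      ∧ (((eps d Lc k : ℝ) : ℂ) • (1 : Matrix _ _ ℂ) - (plaqCov Lc M R k - plaqCov Lc M R k')).PosSemidef := by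
  refine ⟨plaqCov_antitone Lc M hkk', ?_⟩
  have h := (plaqCov_sub_inf_le_one Lc M hL R k).add (plaqCov_sub_inf_posSemidef Lc M hL R k')
  have e : ((eps d Lc k : ℝ) : ℂ) • (1 : Matrix _ _ ℂ) - (plaqCov Lc M R k - plaqCovInf Lc M R) + (plaqCov Lc M R k' - plaqCovInf Lc M R)
      = ((eps d Lc k : ℝ) : ℂ) • (1 : Matrix _ _ ℂ) - (plaqCov Lc M R k - plaqCov Lc M R k') := by abel
  rw [e] at h; exact h

/-! ## §4 Entrywise: road P4's datum `η₀(k₀) = Crate d·Lc^{−2k₀}` -/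

omit [NeZero Lc] hM [DecidableEq c] in
/-- entries of a PSD matrix below `ε • 1` are `≤ ε`. [folklore] -/
theorem norm_apply_le_of_le_smul_one {m : Type*} [Fintype m] [DecidableEq m] {X : Matrix m m ℂ} (hX : X.PosSemidef) {ε : ℝ} (hε : 0 ≤ ε)
    (hle : (((ε : ℝ) : ℂ) • (1 : Matrix m m ℂ) - X).PosSemidef) (a b : m) : ‖X a b‖ ≤ ε := by
  have hdiag : ∀ i, (X i i).re ≤ ε := fun i => by
    have h := re_diag_nonneg hle i
    rw [Matrix.sub_apply, Matrix.smul_apply, Matrix.one_apply_eq, smul_eq_mul, mul_one, Complex.sub_re, Complex.ofReal_re] at h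
    linarith
  have h1 := norm_apply_sq_le hX a b
  have ha := hdiag a; have hb := hdiag b
  have ha0 := re_diag_nonneg hX a; have hb0 := re_diag_nonneg hX b
  have h2 : ‖X a b‖ ^ 2 ≤ ε ^ 2 := by
    calc ‖X a b‖ ^ 2 ≤ (X a a).re * (X b b).re := h1
      _ ≤ ε * ε := mul_le_mul ha hb hb0 hε
      _ = ε ^ 2 := (sq ε).symm
  nlinarith [norm_nonneg (X a b), h2, hε]

/-- **ENTRYWISE RATE TO THE LIMIT**: `‖(plaqCov R k − plaqCovInf R) a b‖ ≤ Crate d·(Lc^k)⁻²` for every `R`, `k`, entry (`Lc ≥ 2`). [folklore] -/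
theorem norm_plaqCov_sub_inf_apply_le (hL : 2 ≤ Lc) (R : Matrix c (Tor M × Fin d) ℂ) (k : ℕ) (a b : Fin d × Fin d × Tor M) :
    ‖(plaqCov Lc M R k - plaqCovInf Lc M R) a b‖ ≤ eps d Lc k :=
  norm_apply_le_of_le_smul_one (plaqCov_sub_inf_posSemidef Lc M hL R k) (eps_nonneg Lc k) (plaqCov_sub_inf_le_one Lc M hL R k) a b

/-- **ENTRYWISE ONE-STEP ∕ TAIL RATE**: `‖(plaqCov R k − plaqCov R k′) a b‖ ≤ Crate d·(Lc^k)⁻²` for `k ≤ k′`. [folklore] -/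
theorem norm_plaqCov_sub_apply_le (hL : 2 ≤ Lc) (R : Matrix c (Tor M × Fin d) ℂ) {k k' : ℕ} (hkk' : k ≤ k') (a b : Fin d × Fin d × Tor M) :
    ‖(plaqCov Lc M R k - plaqCov Lc M R k') a b‖ ≤ eps d Lc k :=
  norm_apply_le_of_le_smul_one (plaqCov_sub_le_one Lc M hL R hkk').1 (eps_nonneg Lc k) (plaqCov_sub_le_one Lc M hL R hkk').2 a b

omit [NeZero Lc] in
/-- `eps` is antitone in the level (`Lc ≥ 1`). [folklore] -/
theorem eps_antitone (hL : 1 ≤ Lc) {k k' : ℕ} (hkk' : k ≤ k') : eps d Lc k' ≤ eps d Lc k := by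
  induction hkk' with
  | refl => exact le_rfl
  | @step m _ ih => exact (eps_succ_le (d := d) Lc hL m).trans ih

/-- **ROAD P4's DATUM, EXPLICIT** (the shape of `MonotoneTorusEffectiveLimit.plaqCov_sub_effInf_le` with `η₀(k₀) := Crate d·(Lc^{k₀})⁻²`):
for every `R`, every `k₀` and all `j ≥ k₀`, `a`, `b`: `‖(plaqCov R j − plaqCovInf R) a b‖ ≤ Crate d·(Lc^{k₀})⁻²` — no trace datum needed. [folklore] -/
theorem plaqCov_datum (hL : 2 ≤ Lc) (R : Matrix c (Tor M × Fin d) ℂ) (k₀ : ℕ) :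
    ∀ j, k₀ ≤ j → ∀ a b, ‖(plaqCov Lc M R j - plaqCovInf Lc M R) a b‖ ≤ Crate d * (((Lc : ℝ) ^ k₀)⁻¹) ^ 2 := fun j hj a b =>
  (norm_plaqCov_sub_inf_apply_le Lc M hL R j a b).trans (eps_antitone (d := d) Lc (by omega) hj)

/-! ## §5 (v1.1, append-only) Junction with road P4's limit statement: `plaqCovInf` IS the entrywise limit of `plaqCov R k` -/

/-- **`plaqCov R k → plaqCovInf R` entrywise** — `plaqCovInf` is by definition the limit object of road P4's `MonotoneTorusEffectiveLimit.plaqCov_tendsto_effInf`;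
so §3–§4 are rates of convergence TO THE LIMIT, not merely Cauchy bounds. [folklore] -/
theorem plaqCov_tendsto_plaqCovInf (R : Matrix c (Tor M × Fin d) ℂ) (a b : Fin d × Fin d × Tor M) :
    Filter.Tendsto (fun k => plaqCov Lc M R k a b) Filter.atTop (nhds (plaqCovInf Lc M R a b)) :=
  MonotoneTorusEffectiveLimit.plaqCov_tendsto_effInf Lc M R a b

/-- **ROAD P4's `plaqCov_sub_effInf_le` WITH ITS DATUM DISCHARGED**: in P4's own spelling of the limit object, for every `R`, `k₀`, `j ≥ k₀`, `a`, `b`: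
`‖(plaqCov R j − curlMat·critCov effInf R·curlMatᴴ) a b‖ ≤ Crate d·(Lc^{k₀})⁻²` (`Lc ≥ 2`) — no trace datum `η₀` is needed any more. [folklore] -/
theorem plaqCov_sub_effInf_le_explicit (hL : 2 ≤ Lc) (R : Matrix c (Tor M × Fin d) ℂ) (k₀ : ℕ) :
    ∀ j, k₀ ≤ j → ∀ a b, ‖(plaqCov Lc M R j - curlMat M * critCov (effInf_posSemidef Lc M).isHermitian R * (curlMat M)ᴴ) a b‖
      ≤ Crate d * (((Lc : ℝ) ^ k₀)⁻¹) ^ 2 :=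
  plaqCov_datum Lc M hL R k₀

end Summit.QuantumFields.BalabanUV.Beta.GAN24.MonotoneTorusCovRate
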